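import Literature.MathematicalPhysics.QuantumManyBody.PeriodicMaxFormSimplicity
import Literature.MathematicalPhysics.QuantumManyBody.PeriodicMaxFormBoundHardCore
import Literature.MathematicalPhysics.QuantumManyBody.PeriodicHardCoreFormData
import Literature.MathematicalPhysics.QuantumManyBody.PeriodicHardCoreCutoffState
import Literature.Analysis.FunctionSpaces.TorusHardCoreCutoff
import Literature.Analysis.FunctionSpaces.TorusLineACLSpectral
import Summits.AtomisticToContinuum.BoseEinsteinCondensation.Theorems.BECConjugateDominationHardCoreExtensionTruncationReduction
import HarnessLib

/-!
# Simplicity of the maximal-form ground-state class from positivity (hard cores allowed) — stub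
# `stub_maxFormSimple_of_positive` (P3) of line `third-law-current-floor`, crux
# `BECConjugateDomination.HardCoreExtension` (stmt-AtomisticToContinuum-11786)

For a repulsive finite-range pair profile `v` (measurable, `v = 0` beyond `R₀`; hard cores `v = ⊤` and
non-integrable singularities allowed), `L > 0` and `E₀ = periodicGroundStateEnergy v N L < ⊤`, let
`𝓜 = maxFormGroundStates v N L` be the ground-state class of the maximal form
`maxForm v L η = ∑ₙ (∑ₚ (2πnₚ/L)²) |⟪eₙ, η⟫|² + ∫ (W ∘ fromUnitTorusN L) |η|²` in the Bose sector.
**If every non-negative non-zero element of `𝓜` is a.e. non-zero, then two non-zero elements of `𝓜` are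
never orthogonal** (`𝓜 ⊆ ℂ·η` for any non-negative non-zero `η ∈ 𝓜`).

This is Reed–Simon's argument for Thm XIII.44 exactly as in the tree file
`PeriodicMaxFormSimplicity.lean` (`inner_ne_zero_of_mem_maxFormGroundStates`), with two changes:

* the Faris–Simon positivity `ae_ne_zero_of_mem_maxFormGroundStates` (which needs `W ∈ L¹` of the cell) is
  replaced by the positivity HYPOTHESIS;
* the hypothesis `W ∈ L¹` of `add_mem_maxFormGroundStates` (used through `reLp`/`imLp`/`posPartLp`
  membership and `sub_mem`) entered only through the maximal-form bound `E₀‖η‖² ≤ maxForm v L η` on the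
  Bose sector; for finite-range `v` this bound is the tree's hard-core theorem
  `periodicGroundStateEnergy_mul_le_maxForm_finiteRange` (`PeriodicMaxFormBoundHardCore.lean`), so the
  whole lattice (`add_mem_maxFormGroundStates_fr`, …) goes through without integrability.

Chain: `re_inner_pos_of_absLp_eq_fr` (two non-negative non-zero ground states have `re⟪η,θ⟫ > 0`),
`absLp_eq_or_eq_neg_of_conjLp_eq_fr` (real ground states have constant sign),
`eq_zero_of_conjLp_eq_of_inner_eq_zero_fr`, `exists_eq_ofReal_smul_of_conjLp_eq_fr`,
`exists_eq_smul_of_mem_maxFormGroundStates_fr`, `inner_ne_zero_of_mem_maxFormGroundStates_fr`.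

References: M. Reed, B. Simon, *Methods of Modern Mathematical Physics IV* (1978), §XIII.12,
Thms XIII.43–XIII.44, XIII.48 (a) [ReedSimonIV1978]; W. Faris, B. Simon, Duke Math. J. 42 (1975) 559–567
[FarisSimon1975]; B. Simon, J. Operator Theory 1 (1979) 37–47 [Simon1979Forms].
-/

noncomputable section

namespace Summit.AtomisticToContinuum.BoseEinsteinCondensation.Cruxes.HardCoreExtension.ThirdLawCurrentFloorAlt

open MeasureTheory Filter UnitAddTorus
open scoped ENNReal NNReal BigOperators Topology InnerProductSpace ComplexConjugate
open Literature.MathematicalPhysics.QuantumManyBody.BoseGas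
open Literature.Analysis.FunctionSpaces
open Summit.AtomisticToContinuum.BoseEinsteinCondensation.Cruxes.StaticResponseBound.UvThomsonForceWave
open Summit.AtomisticToContinuum.BoseEinsteinCondensation.Cruxes.HardCoreExtension.ThirdLawCurrentFloor

-- The measure on `ℝ/ℤ` is the Haar PROBABILITY measure, exactly as in `PeriodicFormDomain.lean` / the skeleton:
attribute [local instance] Literature.MathematicalPhysics.QuantumManyBody.BoseGas.formDomain_measureSpace
  Literature.MathematicalPhysics.QuantumManyBody.BoseGas.formDomain_isProbabilityMeasure
  Literature.MathematicalPhysics.QuantumManyBody.BoseGas.formDomain_isProbabilityMeasure_pi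

/-- Local notation for `L²((ℝ/ℤ)^{3N})`, as in the tree files. -/
local notation "L2T " N':max => Lp ℂ 2 (volume : Measure (UnitAddTorus (Fin N' × Fin 3)))

variable {N : ℕ} {L : ℝ} {v : ℝ → ℝ≥0∞}

/-! ### The maximal-form bound for finite-range potentials and the linear structure of `𝓜` -/

/-- **The maximal-form bound for repulsive finite-range potentials** (hard cores allowed): on the Bose
sector `E₀ ‖η‖² ≤ maxForm v L η` (the tree's `periodicGroundStateEnergy_mul_le_maxForm_finiteRange`).
[cite: ReedSimonIV1978, Thm. XIII.64] -/
theorem periodicGroundStateEnergy_mul_le_maxForm_of_mem_fr (hL : 0 < L) (hvfr : IsRepulsiveFiniteRange v)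
    {η : L2T N} (hη : η ∈ boseSymmetric N) :
    periodicGroundStateEnergy v N L * ENNReal.ofReal (‖η‖ ^ 2) ≤ maxForm v L η := by
  obtain ⟨R₀, hv0⟩ := hvfr.2
  exact periodicGroundStateEnergy_mul_le_maxForm_finiteRange hL hvfr.1 hv0 η hη

/-- **The ground-state class is closed under addition** (finite-range `v`, `E₀ < ∞`): by the parallelogram
law `maxForm(η+ξ) + maxForm(η-ξ) = 2E₀‖η‖² + 2E₀‖ξ‖² = E₀‖η+ξ‖² + E₀‖η-ξ‖²`, and `maxForm(η-ξ) ≥ E₀‖η-ξ‖²`.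
[folklore] -/
theorem add_mem_maxFormGroundStates_fr (hL : 0 < L) (hvfr : IsRepulsiveFiniteRange v)
    (hE : periodicGroundStateEnergy v N L ≠ ⊤) {η ξ : L2T N} (hη : η ∈ maxFormGroundStates v N L)
    (hξ : ξ ∈ maxFormGroundStates v N L) : η + ξ ∈ maxFormGroundStates v N L := by
  set E := periodicGroundStateEnergy v N L with hEdef
  refine ⟨(boseSymmetric N).add_mem hη.1 hξ.1, ?_⟩
  have hlow : E * ENNReal.ofReal (‖η - ξ‖ ^ 2) ≤ maxForm v L (η - ξ) :=
    periodicGroundStateEnergy_mul_le_maxForm_of_mem_fr hL hvfr ((boseSymmetric N).sub_mem hη.1 hξ.1)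
  have hsum : maxForm v L (η + ξ) + maxForm v L (η - ξ) ≤
      E * ENNReal.ofReal (‖η + ξ‖ ^ 2) + E * ENNReal.ofReal (‖η - ξ‖ ^ 2) := by
    rw [maxForm_parallelogram hvfr.1]
    calc 2 * maxForm v L η + 2 * maxForm v L ξ
        ≤ 2 * (E * ENNReal.ofReal (‖η‖ ^ 2)) + 2 * (E * ENNReal.ofReal (‖ξ‖ ^ 2)) := by
          gcongr
          · exact hη.2
          · exact hξ.2
      _ = E * ENNReal.ofReal (2 * ‖η‖ ^ 2 + 2 * ‖ξ‖ ^ 2) := by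
          rw [ENNReal.ofReal_add (by positivity) (by positivity), ENNReal.ofReal_mul zero_le_two,
            ENNReal.ofReal_mul zero_le_two, ENNReal.ofReal_ofNat]
          ring
      _ = E * ENNReal.ofReal (‖η + ξ‖ ^ 2 + ‖η - ξ‖ ^ 2) := by
          congr 1
          congr 1
          have h := parallelogram_law_with_norm ℂ η ξ
          simp only [sq]
          linarith [h]
      _ = E * ENNReal.ofReal (‖η + ξ‖ ^ 2) + E * ENNReal.ofReal (‖η - ξ‖ ^ 2) := by
          rw [ENNReal.ofReal_add (sq_nonneg _) (sq_nonneg _), mul_add]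
  have hfin : E * ENNReal.ofReal (‖η - ξ‖ ^ 2) ≠ ⊤ := ENNReal.mul_ne_top hE ENNReal.ofReal_ne_top
  calc maxForm v L (η + ξ)
      = maxForm v L (η + ξ) + E * ENNReal.ofReal (‖η - ξ‖ ^ 2) - E * ENNReal.ofReal (‖η - ξ‖ ^ 2) :=
        (ENNReal.add_sub_cancel_right hfin).symm
    _ ≤ maxForm v L (η + ξ) + maxForm v L (η - ξ) - E * ENNReal.ofReal (‖η - ξ‖ ^ 2) :=
        tsub_le_tsub_right (add_le_add le_rfl hlow) _
    _ ≤ E * ENNReal.ofReal (‖η + ξ‖ ^ 2) + E * ENNReal.ofReal (‖η - ξ‖ ^ 2) - E * ENNReal.ofReal (‖η - ξ‖ ^ 2) :=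
        tsub_le_tsub_right hsum _
    _ = E * ENNReal.ofReal (‖η + ξ‖ ^ 2) := ENNReal.add_sub_cancel_right hfin

/-- The ground-state class is closed under subtraction (finite-range `v`, `E₀ < ∞`). [folklore] -/
theorem sub_mem_maxFormGroundStates_fr (hL : 0 < L) (hvfr : IsRepulsiveFiniteRange v)
    (hE : periodicGroundStateEnergy v N L ≠ ⊤) {η ξ : L2T N} (hη : η ∈ maxFormGroundStates v N L)
    (hξ : ξ ∈ maxFormGroundStates v N L) : η - ξ ∈ maxFormGroundStates v N L := by
  rw [sub_eq_add_neg]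
  exact add_mem_maxFormGroundStates_fr hL hvfr hE hη (neg_mem_maxFormGroundStates hξ)

/-- **Real parts of ground states are ground states** (finite-range `v`, `E₀ < ∞`).
[cite: ReedSimonIV1978, Thm XIII.43] -/
theorem reLp_mem_maxFormGroundStates_fr (hL : 0 < L) (hvfr : IsRepulsiveFiniteRange v)
    (hE : periodicGroundStateEnergy v N L ≠ ⊤) {η : L2T N} (hη : η ∈ maxFormGroundStates v N L) :
    reLp η ∈ maxFormGroundStates v N L := by
  rw [reLp_eq]
  exact smul_mem_maxFormGroundStates _
    (add_mem_maxFormGroundStates_fr hL hvfr hE hη (conjLp_mem_maxFormGroundStates hη))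

/-- Imaginary parts of ground states are ground states (finite-range `v`, `E₀ < ∞`).
[cite: ReedSimonIV1978, Thm XIII.43] -/
theorem imLp_mem_maxFormGroundStates_fr (hL : 0 < L) (hvfr : IsRepulsiveFiniteRange v)
    (hE : periodicGroundStateEnergy v N L ≠ ⊤) {η : L2T N} (hη : η ∈ maxFormGroundStates v N L) :
    imLp η ∈ maxFormGroundStates v N L := by
  rw [imLp_eq]
  exact smul_mem_maxFormGroundStates _
    (sub_mem_maxFormGroundStates_fr hL hvfr hE hη (conjLp_mem_maxFormGroundStates hη))

/-- **Positive parts of REAL ground states are ground states** (finite-range `v`, `E₀ < ∞`):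
`η⁺ = ½(|η| + η)`. [cite: ReedSimonIV1978, Thm XIII.43 (c)⇒(a)] -/
theorem posPartLp_mem_maxFormGroundStates_fr (hL : 0 < L) (hvfr : IsRepulsiveFiniteRange v)
    (hE : periodicGroundStateEnergy v N L ≠ ⊤) {η : L2T N} (hη : η ∈ maxFormGroundStates v N L)
    (hreal : conjLp η = η) : posPartLp η ∈ maxFormGroundStates v N L := by
  rw [posPartLp_eq_of_conjLp_eq hreal]
  exact smul_mem_maxFormGroundStates _
    (add_mem_maxFormGroundStates_fr hL hvfr hE (absLp_mem_maxFormGroundStates hη) hη)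

/-! ### Perron–Frobenius for the maximal form, from positivity -/

/-- **Two non-negative non-zero ground states are never orthogonal**: `re⟪η, θ⟫ > 0`, since both are
a.e. strictly positive by the positivity hypothesis. [cite: ReedSimonIV1978, Thm XIII.44 (proof)] -/
theorem re_inner_pos_of_absLp_eq_fr
    (hpos : ∀ η : L2T N, η ∈ maxFormGroundStates v N L → absLp η = η → η ≠ 0 →
      ∀ᵐ t ∂(volume : Measure (UnitAddTorus (Fin N × Fin 3))), (η : UnitAddTorus (Fin N × Fin 3) → ℂ) t ≠ 0)
    {η θ : L2T N} (hη : η ∈ maxFormGroundStates v N L) (hηabs : absLp η = η) (hη0 : η ≠ 0)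
    (hθ : θ ∈ maxFormGroundStates v N L) (hθabs : absLp θ = θ) (hθ0 : θ ≠ 0) : 0 < (⟪η, θ⟫_ℂ).re := by
  have hη' := hpos η hη hηabs hη0
  have hθ' := hpos θ hθ hθabs hθ0
  have hηae : ∀ᵐ t ∂(volume : Measure (UnitAddTorus (Fin N × Fin 3))), (η : UnitAddTorus (Fin N × Fin 3) → ℂ) t =
      ((‖(η : UnitAddTorus (Fin N × Fin 3) → ℂ) t‖ : ℝ) : ℂ) := by
    have h := coeFn_absLp η
    rw [hηabs] at h
    exact h
  have hθae : ∀ᵐ t ∂(volume : Measure (UnitAddTorus (Fin N × Fin 3))), (θ : UnitAddTorus (Fin N × Fin 3) → ℂ) t =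
      ((‖(θ : UnitAddTorus (Fin N × Fin 3) → ℂ) t‖ : ℝ) : ℂ) := by
    have h := coeFn_absLp θ
    rw [hθabs] at h
    exact h
  rw [L2.inner_def, ← RCLike.re_to_complex, ← integral_re (L2.integrable_inner η θ)]
  refine (integral_pos_iff_support_of_nonneg_ae ?_ (L2.integrable_inner η θ).re).2 ?_
  · filter_upwards [hηae, hθae] with t h1 h2
    rw [Pi.zero_apply, RCLike.inner_apply, h1, h2, Complex.conj_ofReal, ← Complex.ofReal_mul, RCLike.re_to_complex,
      Complex.ofReal_re]
    positivity
  · have hsupp : ∀ᵐ t ∂(volume : Measure (UnitAddTorus (Fin N × Fin 3))),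
        t ∈ Function.support fun t => RCLike.re ⟪(η : UnitAddTorus (Fin N × Fin 3) → ℂ) t,
          (θ : UnitAddTorus (Fin N × Fin 3) → ℂ) t⟫_ℂ := by
      filter_upwards [hη', hθ', hηae, hθae] with t h1 h2 h3 h4
      rw [Function.mem_support, RCLike.inner_apply, h3, h4, Complex.conj_ofReal, ← Complex.ofReal_mul,
        RCLike.re_to_complex, Complex.ofReal_re]
      rw [h3] at h1
      rw [h4] at h2
      have h1' : ‖(η : UnitAddTorus (Fin N × Fin 3) → ℂ) t‖ ≠ 0 := fun h => h1 (by rw [h, Complex.ofReal_zero])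
      have h2' : ‖(θ : UnitAddTorus (Fin N × Fin 3) → ℂ) t‖ ≠ 0 := fun h => h2 (by rw [h, Complex.ofReal_zero])
      exact mul_ne_zero h2' h1'
    have hcompl : volume (Function.support fun t => RCLike.re ⟪(η : UnitAddTorus (Fin N × Fin 3) → ℂ) t,
        (θ : UnitAddTorus (Fin N × Fin 3) → ℂ) t⟫_ℂ)ᶜ = 0 := mem_ae_iff.1 hsupp
    rw [measure_congr (ae_eq_univ.2 hcompl), measure_univ]
    exact one_pos

/-- **Real ground states have constant sign**: for a real `θ ∈ maxFormGroundStates v N L`, either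
`|θ| = θ` or `|θ| = -θ` (`θ⁺ ∈ maxFormGroundStates` is a.e. `≠ 0` as soon as it is `≠ 0`, forcing `θ⁻ = 0`).
[cite: ReedSimonIV1978, Thm XIII.44 (proof)] -/
theorem absLp_eq_or_eq_neg_of_conjLp_eq_fr (hL : 0 < L) (hvfr : IsRepulsiveFiniteRange v)
    (hE : periodicGroundStateEnergy v N L ≠ ⊤)
    (hpos : ∀ η : L2T N, η ∈ maxFormGroundStates v N L → absLp η = η → η ≠ 0 →
      ∀ᵐ t ∂(volume : Measure (UnitAddTorus (Fin N × Fin 3))), (η : UnitAddTorus (Fin N × Fin 3) → ℂ) t ≠ 0)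
    {θ : L2T N} (hθ : θ ∈ maxFormGroundStates v N L) (hreal : conjLp θ = θ) : absLp θ = θ ∨ absLp θ = -θ := by
  have hposPart := posPartLp_eq_of_conjLp_eq hreal
  have hnegPart := negPartLp_eq_of_conjLp_eq hreal
  by_cases h0 : posPartLp θ = 0
  · right
    rw [h0] at hposPart
    have h2 : absLp θ + θ = 0 := by
      have h := hposPart.symm
      rw [smul_eq_zero] at h
      exact h.resolve_left (by norm_num)
    exact eq_neg_of_add_eq_zero_left h2
  · left
    have hmem := posPartLp_mem_maxFormGroundStates_fr hL hvfr hE hθ hreal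
    have hae := hpos _ hmem (absLp_posPartLp θ) h0
    have hneg0 : negPartLp θ = 0 := by
      refine Lp.eq_zero_iff_ae_eq_zero.2 ?_
      filter_upwards [hae, coeFn_posPartLp θ, coeFn_negPartLp θ] with t h1 h2 h3
      rw [h3, Pi.zero_apply, Complex.ofReal_eq_zero, max_eq_right_iff, neg_nonpos]
      rw [h2] at h1
      by_contra hlt
      push Not at hlt
      exact h1 (by rw [max_eq_right hlt.le, Complex.ofReal_zero])
    rw [hneg0] at hnegPart
    have h2 : absLp θ - θ = 0 := by
      have h := hnegPart.symm
      rw [smul_eq_zero] at h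
      exact h.resolve_left (by norm_num)
    exact sub_eq_zero.1 h2

/-- **A real ground state orthogonal to a non-negative non-zero ground state vanishes.**
[cite: ReedSimonIV1978, Thm XIII.44 (proof)] -/
theorem eq_zero_of_conjLp_eq_of_inner_eq_zero_fr (hL : 0 < L) (hvfr : IsRepulsiveFiniteRange v)
    (hE : periodicGroundStateEnergy v N L ≠ ⊤)
    (hpos : ∀ η : L2T N, η ∈ maxFormGroundStates v N L → absLp η = η → η ≠ 0 →
      ∀ᵐ t ∂(volume : Measure (UnitAddTorus (Fin N × Fin 3))), (η : UnitAddTorus (Fin N × Fin 3) → ℂ) t ≠ 0)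
    {η θ : L2T N} (hη : η ∈ maxFormGroundStates v N L) (hηabs : absLp η = η) (hη0 : η ≠ 0)
    (hθ : θ ∈ maxFormGroundStates v N L) (hreal : conjLp θ = θ) (horth : ⟪η, θ⟫_ℂ = 0) : θ = 0 := by
  by_contra hθ0
  rcases absLp_eq_or_eq_neg_of_conjLp_eq_fr hL hvfr hE hpos hθ hreal with h | h
  · have h1 := re_inner_pos_of_absLp_eq_fr hpos hη hηabs hη0 hθ h hθ0
    rw [horth, Complex.zero_re] at h1
    exact lt_irrefl _ h1
  · have hθ' : absLp (-θ) = -θ := by rw [absLp_neg, h]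
    have h1 := re_inner_pos_of_absLp_eq_fr hpos hη hηabs hη0 (neg_mem_maxFormGroundStates hθ) hθ'
      (neg_ne_zero.2 hθ0)
    rw [inner_neg_right, horth, neg_zero, Complex.zero_re] at h1
    exact lt_irrefl _ h1

/-- **Real ground states are multiples of a non-negative one.** [cite: ReedSimonIV1978, Thm XIII.44 (proof)] -/
theorem exists_eq_ofReal_smul_of_conjLp_eq_fr (hL : 0 < L) (hvfr : IsRepulsiveFiniteRange v)
    (hE : periodicGroundStateEnergy v N L ≠ ⊤)
    (hpos : ∀ η : L2T N, η ∈ maxFormGroundStates v N L → absLp η = η → η ≠ 0 →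
      ∀ᵐ t ∂(volume : Measure (UnitAddTorus (Fin N × Fin 3))), (η : UnitAddTorus (Fin N × Fin 3) → ℂ) t ≠ 0)
    {η θ : L2T N} (hη : η ∈ maxFormGroundStates v N L) (hηabs : absLp η = η) (hη0 : η ≠ 0)
    (hθ : θ ∈ maxFormGroundStates v N L) (hreal : conjLp θ = θ) : ∃ c : ℝ, θ = (c : ℂ) • η := by
  have hηreal : conjLp η = η := by
    rw [← hηabs]
    exact conjLp_absLp η
  obtain ⟨r, hr⟩ : ∃ r : ℝ, (r : ℂ) = ⟪η, θ⟫_ℂ :=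
    ⟨(⟪η, θ⟫_ℂ).re, Complex.conj_eq_iff_re.1 (conj_inner_of_conjLp_eq hηreal hreal)⟩
  have hn0 : ‖η‖ ≠ 0 := norm_ne_zero_iff.2 hη0
  have hself : ⟪η, η⟫_ℂ = ((‖η‖ : ℝ) : ℂ) ^ 2 := inner_self_eq_norm_sq_to_K (𝕜 := ℂ) η
  refine ⟨r / ‖η‖ ^ 2, ?_⟩
  have hmem : θ - ((r / ‖η‖ ^ 2 : ℝ) : ℂ) • η ∈ maxFormGroundStates v N L :=
    sub_mem_maxFormGroundStates_fr hL hvfr hE hθ (smul_mem_maxFormGroundStates _ hη)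
  have hreal' := conjLp_sub_ofReal_smul hreal hηreal (r / ‖η‖ ^ 2)
  have hcoef : ((r / ‖η‖ ^ 2 : ℝ) : ℂ) * ((‖η‖ : ℝ) : ℂ) ^ 2 = (r : ℂ) := by
    rw [← Complex.ofReal_pow, ← Complex.ofReal_mul, div_mul_cancel₀ _ (pow_ne_zero 2 hn0)]
  have horth : ⟪η, θ - ((r / ‖η‖ ^ 2 : ℝ) : ℂ) • η⟫_ℂ = 0 := by
    rw [inner_sub_right, inner_smul_right, hself, hcoef, ← hr, sub_self]
  have h0 := eq_zero_of_conjLp_eq_of_inner_eq_zero_fr hL hvfr hE hpos hη hηabs hη0 hmem hreal' horth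
  exact sub_eq_zero.1 h0

/-- **The ground-state class of the maximal form is one-dimensional** (Perron–Frobenius, from positivity):
every ground state is a complex multiple of any fixed non-negative non-zero ground state.
[cite: ReedSimonIV1978, Thms XIII.43–XIII.44 and Thm XIII.48 (a)] -/
theorem exists_eq_smul_of_mem_maxFormGroundStates_fr (hL : 0 < L) (hvfr : IsRepulsiveFiniteRange v)
    (hE : periodicGroundStateEnergy v N L ≠ ⊤)
    (hpos : ∀ η : L2T N, η ∈ maxFormGroundStates v N L → absLp η = η → η ≠ 0 →
      ∀ᵐ t ∂(volume : Measure (UnitAddTorus (Fin N × Fin 3))), (η : UnitAddTorus (Fin N × Fin 3) → ℂ) t ≠ 0)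
    {η ξ : L2T N} (hη : η ∈ maxFormGroundStates v N L) (hηabs : absLp η = η) (hη0 : η ≠ 0)
    (hξ : ξ ∈ maxFormGroundStates v N L) : ∃ c : ℂ, ξ = c • η := by
  obtain ⟨a, ha⟩ := exists_eq_ofReal_smul_of_conjLp_eq_fr hL hvfr hE hpos hη hηabs hη0
    (reLp_mem_maxFormGroundStates_fr hL hvfr hE hξ) (conjLp_reLp ξ)
  obtain ⟨b, hb⟩ := exists_eq_ofReal_smul_of_conjLp_eq_fr hL hvfr hE hpos hη hηabs hη0
    (imLp_mem_maxFormGroundStates_fr hL hvfr hE hξ) (conjLp_imLp ξ)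
  refine ⟨(a : ℂ) + Complex.I * (b : ℂ), ?_⟩
  rw [← reLp_add_I_smul_imLp ξ, ha, hb, smul_smul, ← add_smul]

/-- **Two non-zero ground states are never orthogonal** (finite-range `v`, hard cores allowed, from
positivity of non-negative ground states). [cite: ReedSimonIV1978, Thm XIII.44] -/
theorem inner_ne_zero_of_mem_maxFormGroundStates_fr (hL : 0 < L) (hvfr : IsRepulsiveFiniteRange v)
    (hE : periodicGroundStateEnergy v N L ≠ ⊤)
    (hpos : ∀ η : L2T N, η ∈ maxFormGroundStates v N L → absLp η = η → η ≠ 0 →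
      ∀ᵐ t ∂(volume : Measure (UnitAddTorus (Fin N × Fin 3))), (η : UnitAddTorus (Fin N × Fin 3) → ℂ) t ≠ 0)
    {x y : L2T N} (hx : x ∈ maxFormGroundStates v N L) (hy : y ∈ maxFormGroundStates v N L) (hx0 : x ≠ 0)
    (hy0 : y ≠ 0) : ⟪x, y⟫_ℂ ≠ 0 := by
  have hη : absLp x ∈ maxFormGroundStates v N L := absLp_mem_maxFormGroundStates hx
  have hη0 : absLp x ≠ 0 := fun h => by
    have h1 := norm_absLp x
    rw [h, norm_zero] at h1
    exact hx0 (norm_eq_zero.1 h1.symm)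
  obtain ⟨a, ha⟩ := exists_eq_smul_of_mem_maxFormGroundStates_fr hL hvfr hE hpos hη (absLp_absLp x) hη0 hx
  obtain ⟨b, hb⟩ := exists_eq_smul_of_mem_maxFormGroundStates_fr hL hvfr hE hpos hη (absLp_absLp x) hη0 hy
  have ha0 : a ≠ 0 := by
    rintro rfl
    exact hx0 (by rw [ha, zero_smul])
  have hb0 : b ≠ 0 := by
    rintro rfl
    exact hy0 (by rw [hb, zero_smul])
  have hn : (‖absLp x‖ : ℂ) ≠ 0 := by exact_mod_cast norm_ne_zero_iff.2 hη0
  rw [ha, hb, inner_smul_left, inner_smul_right, inner_self_eq_norm_sq_to_K]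
  exact mul_ne_zero ((map_ne_zero _).2 ha0) (mul_ne_zero hb0 (pow_ne_zero 2 hn))

/-! ### The registered stub -/

/-- **P3 `stub_maxFormSimple_of_positive`** (Reed–Simon's simplicity argument, class-blind). For a repulsive
finite-range `v` (hard cores allowed), `L > 0`, `E₀(v) < ⊤`: IF every non-negative non-zero maximal-form
ground state is a.e. non-zero, THEN two non-zero ground states are never orthogonal (the ground-state class
is `ℂ·η`). [cite: ReedSimonIV1978, Thm XIII.44] -/
theorem stub_maxFormSimple_of_positive :
    ∀ v : ℝ → ℝ≥0∞, IsRepulsiveFiniteRange v → ∀ (N : ℕ) (L : ℝ), 0 < L →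
      periodicGroundStateEnergy v N L ≠ ⊤ →
      (∀ η : Lp ℂ 2 (volume : Measure (UnitAddTorus (Fin N × Fin 3))),
        η ∈ maxFormGroundStates v N L → absLp η = η → η ≠ 0 →
        ∀ᵐ t ∂(volume : Measure (UnitAddTorus (Fin N × Fin 3))),
          (η : UnitAddTorus (Fin N × Fin 3) → ℂ) t ≠ 0) →
      ∀ η θ : Lp ℂ 2 (volume : Measure (UnitAddTorus (Fin N × Fin 3))),
        η ∈ maxFormGroundStates v N L → θ ∈ maxFormGroundStates v N L → η ≠ 0 → θ ≠ 0 → ⟪η, θ⟫_ℂ ≠ 0 := by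
  intro v hvfr N L hL hE hpos η θ hη hθ hη0 hθ0
  exact inner_ne_zero_of_mem_maxFormGroundStates_fr hL hvfr hE hpos hη hθ hη0 hθ0

end Summit.AtomisticToContinuum.BoseEinsteinCondensation.Cruxes.HardCoreExtension.ThirdLawCurrentFloorAlt

end
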